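import Summits.NavierStokesRegularity.NavierStokesRegularity.Theorems.ApexLocalisation.Negative.LogicAndLoadBearing
import Literature.Analysis.FluidPDE.KinematicApexWitness

/-!
# `ApexLocalisation` (crux stmt-NavierStokesRegularity-11719): the Navier–Stokes equations are
# load-bearing; the route target is not a kinematic triviality — negative-side support (cdisprove, gen 2)

Third file of importable lemmas of the standing disprover of `RellichScar.ApexLocalisation`
(companions: `Negative/LogicAndLoadBearing.lean` — imported —, `Negative/FinalSlice.lean`, `Negative/AEForm.lean`),
over the landed explicit witness `Literature/Analysis/FluidPDE/KinematicApexWitness.lean`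
(`ParabolicBump.apexVelocity = χ(‖x‖²/(−t))/√(−t) · e₀`: smooth on the open slab, weak gradient,
`𝐈(ℝ³ × ℝ₋) < ⊤`, apex bound `3/(‖x‖ + √(−t))`, backward-singular origin):

* `target_false_without_SWS` — the route TARGET `NoApexTypeIProfile` (item 11716) is FALSE with
  `IsSuitableWeakSolutionOn` dropped: X is a genuinely dynamical statement and the tree's
  `typeIBound` / `HasTypeIDecay` / `IsBackwardSingularPoint` carry no junk making it vacuous;
* `ApexLocalisationWithoutSWS`, `apexLocalisationWithoutSWS_iff_not_target`,
  `apexLocalisation_false_without_SWS` — the Navier–Stokes equations of the GIVEN profile are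
  load-bearing in the crux (with `Negative/LogicAndLoadBearing`: each of SWS, `𝐈 < ⊤`, Sing₀
  dropped ⇒ crux ↔ ¬X);
* `kinematicCrux_holds` — with the equations dropped on BOTH sides the crux is TRUE: the function
  classes pose no obstruction, isolation must come from the dynamics;
(The witness also realises the apex picture `Σ = {0}` of `Negative/FinalSlice`:
`finalSliceSingularSet_subset_of_apex ParabolicBump.apex_hasTypeIDecay`.)

## References

* G. Koch, N. Nadirashvili, G. Seregin, V. Šverák, Acta Math. 203 (2009), (1.4), (1.6). [KNSS2009]
* D. Albritton, T. Barker, J. Math. Fluid Mech. 21 (2019), §1. [AlbrittonBarker2019]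
-/

noncomputable section

open MeasureTheory TopologicalSpace Set Function Filter Topology Metric
open scoped InnerProductSpace RealInnerProductSpace ENNReal NNReal
open Literature.Analysis.FluidPDE
open Summit.NavierStokesRegularity.NavierStokesRegularity.Theses

set_option linter.dupNamespace false

namespace Summit.NavierStokesRegularity.NavierStokesRegularity.Theorems.ApexLocalisation.Negative

/-- Physical space. -/
local notation "ℝ³" => EuclideanSpace ℝ (Fin 3)

/-- The open backward slab `(-∞,0) × ℝ³` (time first), as in the route file. -/
local notation "𝕊" => Literature.Analysis.FluidPDE.slab (EuclideanSpace ℝ (Fin 3)) (Set.Iio (0 : ℝ)) isOpen_Iio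

/-! ## The Navier–Stokes equations are load-bearing (explicit kinematic witness with `𝐈 < ⊤`)

Everything in `IsApexProfile` except the Navier–Stokes equations is satisfiable simultaneously.
The witness is `u(t,x) = χ(‖x‖²/(−t))/√(−t) · e₀` with a smooth cutoff `χ` (`= 1` on `s ≤ 1`,
`= 0` on `s ≥ 2`): a self-similar bump filling the backward paraboloid `‖x‖ ≲ √(−t)`. -/


/-- **X is false without the Navier–Stokes equations** (`_false_without_` theorem for the route
TARGET `NoApexTypeIProfile`, item 11716): dropping `IsSuitableWeakSolutionOn` from the apex class
leaves a class inhabited by the explicit kinematic witness (`𝐈 < ⊤`, weak gradient, apex bound,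
singular origin, pressure `0`). So X is a genuinely dynamical statement, and the tree's
`typeIBound` / `HasTypeIDecay` / `IsBackwardSingularPoint` carry no junk making it vacuous. -/
theorem target_false_without_SWS :
    ¬ ∀ (u : ℝ → ℝ³ → ℝ³) (p : ℝ → ℝ³ → ℝ) (G : ℝ → ℝ³ → ℝ³ →L[ℝ] ℝ³) (C : ℝ),
        HasWeakSpatialGradientOn 𝕊 u G → typeIBound (Set.Iio (0 : ℝ) ×ˢ Set.univ) u p G < ⊤ →
          HasTypeIDecay C u → ¬ IsBackwardSingularPoint u 0 := by
  intro h
  exact h _ 0 _ 3 ParabolicBump.apex_hasWeakSpatialGradientOn ParabolicBump.typeIBound_apex_lt_top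
    ParabolicBump.apex_hasTypeIDecay ParabolicBump.apex_isBackwardSingularPoint

/-- The same witness inhabits the kinematic RATE class (antecedent of the crux minus SWS). -/
theorem rateClass_kinematically_inhabited :
    ∃ (C : ℝ) (u : ℝ → ℝ³ → ℝ³) (p : ℝ → ℝ³ → ℝ) (G : ℝ → ℝ³ → ℝ³ →L[ℝ] ℝ³),
      HasWeakSpatialGradientOn 𝕊 u G ∧ typeIBound (Set.Iio (0 : ℝ) ×ˢ Set.univ) u p G < ⊤ ∧
        HasTypeITimeDecay C u ∧ IsBackwardSingularPoint u 0 :=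
  ⟨1, _, 0, _, ParabolicBump.apex_hasWeakSpatialGradientOn, ParabolicBump.typeIBound_apex_lt_top,
    ParabolicBump.apex_hasTypeITimeDecay, ParabolicBump.apex_isBackwardSingularPoint⟩

/-- The crux with `IsSuitableWeakSolutionOn` DROPPED from the antecedent (conclusion verbatim). -/
def ApexLocalisationWithoutSWS : Prop :=
  ∀ C : ℝ, (∃ (u : ℝ → ℝ³ → ℝ³) (p : ℝ → ℝ³ → ℝ) (G : ℝ → ℝ³ → ℝ³ →L[ℝ] ℝ³),
    HasWeakSpatialGradientOn 𝕊 u G ∧ typeIBound (Set.Iio (0 : ℝ) ×ˢ Set.univ) u p G < ⊤ ∧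
      HasTypeITimeDecay C u ∧ IsBackwardSingularPoint u 0) → ApexProfileExists

/-- **The Navier–Stokes equations of the GIVEN profile are load-bearing**: without them the crux
is `¬ X` (this completes §2: each of SWS, `𝐈 < ⊤`, Sing₀ is load-bearing). -/
theorem apexLocalisationWithoutSWS_iff_not_target :
    ApexLocalisationWithoutSWS ↔ ¬ RellichScar.NoApexTypeIProfile := by
  rw [noApexTypeIProfile_iff, not_not]
  constructor
  · intro h
    obtain ⟨C, u, p, G, hw⟩ := rateClass_kinematically_inhabited
    exact h C ⟨u, p, G, hw⟩
  · intro h C _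
    exact h

/-- `_false_without_` form. -/
theorem apexLocalisation_false_without_SWS (hX : RellichScar.NoApexTypeIProfile) :
    ¬ ApexLocalisationWithoutSWS :=
  fun h => (apexLocalisationWithoutSWS_iff_not_target.1 h) hX

/-- **The fully kinematic crux is TRUE**: dropping the Navier–Stokes equations on BOTH sides, the
rate-class-minus-SWS (inhabited) does produce an apex-class-minus-SWS member — the witness itself.
So the function classes pose no obstruction; the whole difficulty of the crux is to produce a
Navier–Stokes SOLUTION with an isolated apex (dynamics, not kinematics). -/
theorem kinematicCrux_holds :
    (∃ (C : ℝ) (u : ℝ → ℝ³ → ℝ³) (p : ℝ → ℝ³ → ℝ) (G : ℝ → ℝ³ → ℝ³ →L[ℝ] ℝ³),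
      HasWeakSpatialGradientOn 𝕊 u G ∧ typeIBound (Set.Iio (0 : ℝ) ×ˢ Set.univ) u p G < ⊤ ∧
        HasTypeITimeDecay C u ∧ IsBackwardSingularPoint u 0) →
    ∃ (C : ℝ) (u : ℝ → ℝ³ → ℝ³) (p : ℝ → ℝ³ → ℝ) (G : ℝ → ℝ³ → ℝ³ →L[ℝ] ℝ³),
      HasWeakSpatialGradientOn 𝕊 u G ∧ typeIBound (Set.Iio (0 : ℝ) ×ˢ Set.univ) u p G < ⊤ ∧
        HasTypeIDecay C u ∧ IsBackwardSingularPoint u 0 :=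
  fun _ => ⟨3, _, 0, _, ParabolicBump.apex_hasWeakSpatialGradientOn, ParabolicBump.typeIBound_apex_lt_top,
    ParabolicBump.apex_hasTypeIDecay, ParabolicBump.apex_isBackwardSingularPoint⟩


end Summit.NavierStokesRegularity.NavierStokesRegularity.Theorems.ApexLocalisation.Negative
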